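import Literature.Probability.Percolation.FKFreeLoopRepresentation
import Literature.Probability.Percolation.IsoradialRectangularLoopsBridge
import Literature.Probability.Percolation.FKLoopNestingDensityLimit
import Literature.Probability.Percolation.LoopDensity
import Literature.Probability.Percolation.InterfaceLoopWindingSign
import Literature.Probability.Percolation.FKLoopNestingIntegrable
import Literature.Probability.LatticeModels.MedialTrailUmlaufsatz
import HarnessLib

/-!
# Winding numbers of the loops of the loop representation on the cells of the medial lattice

Fourth input of the finite-volume Baxter–Kelland–Wu identity behind DKLM 2026, (3.2) / Cor. 10
(`dklm2026_corollary10`): the bridge between the ANALYTIC winding number of a loop of the loop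
representation (`(loopCurve δ 0 γ).wind`, through which `loopInterior` and DKLM's loop functional
`∏ cos_μ(φ(int ℓ))` = `loopNestingWeight` are defined) and the COMBINATORIAL winding number
`MedialTrail.wnd` of the same loop read as a closed trail of the oriented medial graph
(`MedialTrailUmlaufsatz`), which is a sum of per-dart contributions `dartWnd` and therefore makes
the `φ`-mass of the interior of a loop an additive functional of its corners — the form
`τ_S ∑_{c ∈ S} κ c` consumed by the BKW identity `bkw_free_piece`.

* `vcell`, `fcell`, `cornerDart` — the cells (faces of the medial lattice, in the medial
  coordinates of `MedialTrail`: unit squares `F ∈ ℤ²`) around a vertex / a face of `ℤ²`, and the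
  dart of a corner; `lf_cornerDart`, `rf_cornerDart` (the vertex cell is on the left, the face
  cell on the right of the dart of a corner).
* `orbitTrail` — the orbit loop `orbitLoop β p` in medial coordinates; `isTrail_orbitTrail`,
  `inv_orbitTrail` (Umlaufsatz and sign of the winding number, from `inv_cornerOrbit`).
* **`wind_orbitLoop_meshPoint_eq_wnd`, `wind_orbitLoop_faceCenter_eq_wnd`** — the analytic
  winding number of the orbit loop around a vertex `v` (a face centre `c_f`) equals the
  combinatorial winding number of the orbit trail around the cell of `v` (of `f`): both jump by
  one exactly across the darts of the loop (`InterfaceWindingJump` / `MedialTrail.IsTrail.wnd_lf`)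
  and vanish far away, and the cells are connected through corners.
* `cellInterior`, `medialLines`, `volume_medialLines` — the open cells of `δ = 1` cover the
  plane up to the (Lebesgue-null) medial lines; the trace of a loop lies on the medial lines, so
  its winding number is constant on each open cell (`wind_orbitLoop_eq_wnd_of_mem_cellInterior`).
* **`signedMeasure_loopInterior_orbitLoop`** — for a signed measure `φ` charging no Lebesgue-null
  set and every `δ > 0`: `φ(int ℓ) = τ · ∑_{m<Q} κ_{φ,δ}(ρ^m p)` for the loop `ℓ` of the orbit of
  a periodic corner `p` drawn at mesh `δ`, where `τ = ±1` is its sense of rotation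
  (`orbitSign`, a quarter of the sum of its turn signs) and
  `κ_{φ,δ}(c) = ∑_{F} dartWnd(dart c, F) · φ(δ · cell F)` (`cornerKappa`) is a functional of the
  single corner `c`.

Everything is proved; the definitions are objects; no named fact is introduced.

## References

* H. Duminil-Copin, K. K. Kozlowski, P. Lammers, I. Manolescu, arXiv:2603.06268 (2026), §3.2
  (`int(ℓ)`, identity (3.2)). [DuminilCopinKozlowskiLammersManolescu2026]
* R. J. Baxter, S. B. Kelland, F. Y. Wu, J. Phys. A 9 (1976), §3. [BaxterKellandWu1976]
* H. Hopf, Compositio Math. 2 (1935), Satz I. [Hopf1935]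
-/

noncomputable section

open Set Function Finset MeasureTheory Complex
open scoped Real

namespace Literature.Probability.Percolation

open LatticeModels RandomPlanarGeometry MedialTrail

/-! ### Cells and darts in medial coordinates -/

/-- The cell (face of the medial lattice, a unit square of `MedialTrail`'s medial coordinates
`(x, y) ↦ (x + y - ½, y - x + ½)`) centred at the vertex `v` of `ℤ²`. [folklore] -/
def vcell (v : Site 2) : MedialTrail.Pt := (v 0 + v 1 - 1, v 1 - v 0)

/-- The cell centred at the centre of the face `f` of `ℤ²` (lower-left corner `f`). [folklore] -/
def fcell (f : Site 2) : MedialTrail.Pt := (f 0 + f 1, f 1 - f 0)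

/-- The dart of the oriented medial graph carried by the corner `c`: from the midpoint of its
source edge one unit in direction `cdir c.2` (to the midpoint of its target edge).
[cite: Smirnov2010, §4, Fig. 5] -/
def cornerDart (c : Site 2 × Fin 4) : MedialTrail.Pt × MedialTrail.Pt :=
  (cpos c, ((cpos c).1 + (cdir c.2).1, (cpos c).2 + (cdir c.2).2))

/-- The dart of a corner ends at the coded position of its successor (any configuration).
[cite: Smirnov2010, §4] -/
theorem cornerDart_eq (β : BondConfig (Site 2)) (c : Site 2 × Fin 4) :
    cornerDart c = (cpos c, cpos (nextCorner β c)) := by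
  rw [cornerDart, cpos_nextCorner]

/-- The dart of a corner is a dart of the oriented medial graph. [cite: Smirnov2010, §4] -/
theorem isDart_cornerDart (c : Site 2 × Fin 4) : IsDart (cornerDart c).1 (cornerDart c).2 := by
  rw [cornerDart_eq ∅]; exact isDart_cpos ∅ c

/-- A corner is determined by its dart. [folklore] -/
theorem cornerDart_injective : Function.Injective cornerDart := by
  intro p q h
  simp only [cornerDart, Prod.mk.injEq] at h
  obtain ⟨h1, h2, h3⟩ := h
  have h1' := congrArg Prod.fst h1
  have h1'' := congrArg Prod.snd h1
  have hk : p.2 = q.2 := cdir_injective (Prod.ext (by omega) (by omega))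
  exact eq_of_cpos_eq h1 hk

/-- **The cell of the vertex of a corner lies to the LEFT of its dart.** [folklore] -/
theorem lf_cornerDart (c : Site 2 × Fin 4) : lf (cornerDart c) = vcell c.1 := by
  obtain ⟨v, k⟩ := c
  fin_cases k <;> simp [cornerDart, cpos, cposOff, cdir, lf, vcell] <;> split_ifs <;>
    simp only [Prod.mk.injEq, and_true] <;> omega

/-- The cells of the four faces around `v`. [folklore] -/
theorem fcell_cFace (v : Site 2) (k : Fin 4) :
    fcell (cFace (v, k)) =
      ![(v 0 + v 1, v 1 - v 0), (v 0 + v 1 - 1, v 1 - v 0 + 1), (v 0 + v 1 - 2, v 1 - v 0),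
        (v 0 + v 1 - 1, v 1 - v 0 - 1)] k := by
  fin_cases k <;> simp [fcell, cFace, faceAt, cornerOff, Pi.sub_apply] <;> omega

/-- **The cell of the face of a corner lies to the RIGHT of its dart.** [folklore] -/
theorem rf_cornerDart (c : Site 2 × Fin 4) : rf (cornerDart c) = fcell (cFace c) := by
  obtain ⟨v, k⟩ := c
  rw [fcell_cFace]
  fin_cases k <;> simp [cornerDart, cpos, cposOff, cdir, rf] <;> split_ifs <;>
    simp only [Prod.mk.injEq, and_true] <;> omega

/-! ### The orbit trail -/

section Orbit

variable {β : BondConfig (Site 2)} {p : Site 2 × Fin 4}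

/-- The orbit loop of the periodic corner `p` in medial coordinates: the coded positions of
`p, ρ p, …, ρ^{Q-1} p`. [cite: Smirnov2010, §4] -/
def orbitTrail (β : BondConfig (Site 2)) (p : Site 2 × Fin 4) : List MedialTrail.Pt :=
  (List.range (minimalPeriod (nextCorner β) p)).map fun m ↦ cpos ((nextCorner β)^[m] p)

/-- The orbit trail is the coded corner orbit of the tree. [folklore] -/
theorem orbitTrail_eq_cornerOrbit (β : BondConfig (Site 2)) (p : Site 2 × Fin 4) :
    orbitTrail β p = (List.range (minimalPeriod (nextCorner β) p)).map fun m ↦ cpos (cornerOrbit β p m) := by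
  unfold orbitTrail
  exact List.map_congr_left fun m _ ↦ by rw [cornerOrbit_eq_iterate]

/-- Minimality of the period, in the tree's phrasing. [folklore] -/
theorem cornerOrbit_ne_of_lt_minimalPeriod (hp : p ∈ periodicPts (nextCorner β)) :
    ∀ s, 0 < s → s < minimalPeriod (nextCorner β) p → cornerOrbit β p s ≠ p := by
  intro s hs0 hs h
  rw [cornerOrbit_eq_iterate] at h
  have hQ := minimalPeriod_pos_of_mem_periodicPts hp
  have := (iterate_eq_iterate_iff_of_lt_minimalPeriod hs hQ).1 (h.trans (iterate_zero_apply _ _).symm)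
  omega

/-- **The orbit trail of a periodic corner is a closed trail of the oriented medial graph.**
[cite: Smirnov2010, §4] -/
theorem isTrail_orbitTrail (hp : p ∈ periodicPts (nextCorner β)) : IsTrail (orbitTrail β p) := by
  rw [orbitTrail_eq_cornerOrbit]
  exact isTrail_cornerOrbit (minimalPeriod_pos_of_mem_periodicPts hp)
    (by rw [cornerOrbit_eq_iterate]; exact iterate_minimalPeriod) (cornerOrbit_ne_of_lt_minimalPeriod hp)

/-- The darts of the orbit trail are the darts of the corners of the orbit. [cite: Smirnov2010, §4] -/
theorem cdarts_orbitTrail (β : BondConfig (Site 2)) (p : Site 2 × Fin 4) :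
    cdarts (orbitTrail β p) =
      (List.range (minimalPeriod (nextCorner β) p)).map fun m ↦ cornerDart ((nextCorner β)^[m] p) := by
  rw [orbitTrail, MedialTrail.cdarts_map_range _ (by simp only [iterate_minimalPeriod, iterate_zero_apply])]
  refine List.map_congr_left fun m _ ↦ ?_
  rw [cornerDart_eq β, iterate_succ_apply']

/-- **Dart membership in the orbit trail is orbit membership.** [cite: Smirnov2010, §4] -/
theorem mem_cdarts_orbitTrail_iff (hp : p ∈ periodicPts (nextCorner β)) {c : Site 2 × Fin 4} :
    cornerDart c ∈ cdarts (orbitTrail β p) ↔ ∃ m, (nextCorner β)^[m] p = c := by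
  rw [cdarts_orbitTrail, List.mem_map, exists_iterate_lt_iff hp]
  constructor
  · rintro ⟨m, hm, h⟩
    exact ⟨m, List.mem_range.1 hm, cornerDart_injective h⟩
  · rintro ⟨m, hm, rfl⟩
    exact ⟨m, List.mem_range.2 hm, rfl⟩

/-- The sense of rotation `τ = (∑_{m<Q} turnSign β (ρ^m p))/4` of the orbit loop of `p` (`±1`
for a periodic corner, by the Umlaufsatz). [cite: Hopf1935, Satz I] -/
def orbitSign (β : BondConfig (Site 2)) (p : Site 2 × Fin 4) : ℝ :=
  (∑ m ∈ Finset.range (minimalPeriod (nextCorner β) p), turnSign β ((nextCorner β)^[m] p) : ℤ) / 4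

/-- **Umlaufsatz and sign of the winding number for the orbit trail**: either the turn signs sum
to `4` and the combinatorial winding number is everywhere `0` or `1`, or they sum to `-4` and it
is everywhere `0` or `-1`. [cite: Hopf1935, Satz I] -/
theorem inv_orbitTrail (hp : p ∈ periodicPts (nextCorner β)) :
    (∑ m ∈ Finset.range (minimalPeriod (nextCorner β) p), turnSign β ((nextCorner β)^[m] p) = 4 ∧
        ∀ F, wnd (orbitTrail β p) F = 0 ∨ wnd (orbitTrail β p) F = 1) ∨
      (∑ m ∈ Finset.range (minimalPeriod (nextCorner β) p), turnSign β ((nextCorner β)^[m] p) = -4 ∧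
        ∀ F, wnd (orbitTrail β p) F = 0 ∨ wnd (orbitTrail β p) F = -1) := by
  have h := inv_cornerOrbit (minimalPeriod_pos_of_mem_periodicPts hp)
    (by rw [cornerOrbit_eq_iterate]; exact iterate_minimalPeriod) (cornerOrbit_ne_of_lt_minimalPeriod hp)
  rw [← orbitTrail_eq_cornerOrbit] at h
  have hs : ∑ m ∈ Finset.range (minimalPeriod (nextCorner β) p), turnSign β (cornerOrbit β p m) =
      ∑ m ∈ Finset.range (minimalPeriod (nextCorner β) p), turnSign β ((nextCorner β)^[m] p) :=
    Finset.sum_congr rfl fun m _ ↦ by rw [cornerOrbit_eq_iterate]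
  rwa [hs] at h

/-- **The winding number of the orbit trail is its sign where it is non-zero.**
[cite: Hopf1935, Satz I] -/
theorem wnd_orbitTrail_eq_orbitSign (hp : p ∈ periodicPts (nextCorner β)) {F : MedialTrail.Pt}
    (hF : wnd (orbitTrail β p) F ≠ 0) : (wnd (orbitTrail β p) F : ℝ) = orbitSign β p := by
  unfold orbitSign
  rcases inv_orbitTrail hp with ⟨hs, hw⟩ | ⟨hs, hw⟩
  · rcases hw F with h | h
    · exact absurd h hF
    · rw [h, hs]; norm_num
  · rcases hw F with h | h
    · exact absurd h hF
    · rw [h, hs]; norm_num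

/-- The sense of rotation is `±1`. [cite: Hopf1935, Satz I] -/
theorem orbitSign_eq_or (hp : p ∈ periodicPts (nextCorner β)) : orbitSign β p = 1 ∨ orbitSign β p = -1 := by
  unfold orbitSign
  rcases inv_orbitTrail hp with ⟨hs, -⟩ | ⟨hs, -⟩
  · left; rw [hs]; norm_num
  · right; rw [hs]; norm_num

/-- `1[wnd ≠ 0] = τ · wnd` for the orbit trail. [cite: Hopf1935, Satz I] -/
theorem indicator_wnd_orbitTrail (hp : p ∈ periodicPts (nextCorner β)) (F : MedialTrail.Pt) :
    (if wnd (orbitTrail β p) F ≠ 0 then (1 : ℝ) else 0) = orbitSign β p * wnd (orbitTrail β p) F := by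
  split_ifs with h
  · rw [wnd_orbitTrail_eq_orbitSign hp h]
    rcases orbitSign_eq_or hp with h1 | h1 <;> rw [h1] <;> norm_num
  · rw [not_ne_iff] at h
    rw [h]; simp

/-! ### The bridge: analytic winding numbers around vertices and face centres -/

open scoped Classical in
/-- **Combinatorial jump across the dart of a corner**, in lattice terms: across the dart of a
corner ON the orbit, `wnd` at the vertex cell exceeds `wnd` at the face cell by one; OFF the orbit
they agree. [folklore] -/
theorem wnd_vcell_sub_wnd_fcell (hp : p ∈ periodicPts (nextCorner β)) (c : Site 2 × Fin 4) :
    wnd (orbitTrail β p) (vcell c.1) - wnd (orbitTrail β p) (fcell (cFace c)) =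
      if ∃ m, (nextCorner β)^[m] p = c then 1 else 0 := by
  classical
  have hT := isTrail_orbitTrail hp
  rw [← lf_cornerDart, ← rf_cornerDart]
  split_ifs with h
  · rw [hT.wnd_lf ((mem_cdarts_orbitTrail_iff hp).2 h)]; ring
  · rw [wnd_lf_eq_rf hT.2.2 (isDart_cornerDart c) (fun hm ↦ h ((mem_cdarts_orbitTrail_iff hp).1 hm))]
    ring

open scoped Classical in
/-- **Analytic jump across the dart of a corner** (from `FKFreeLoopRepresentation`). [cite: arXiv201211672v2, §1.1] -/
theorem wind_meshPoint_sub_wind_faceCenter_orbitLoop (hp : p ∈ periodicPts (nextCorner β)) (c : Site 2 × Fin 4) :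
    (loopCurve 1 0 (orbitLoop β p)).wind (meshPoint 1 c.1) -
        (loopCurve 1 0 (orbitLoop β p)).wind (faceCenter (cFace c)) =
      if ∃ m, (nextCorner β)^[m] p = c then 1 else 0 := by
  classical
  split_ifs with h
  · rw [wind_orbitLoop_vertex_of_mem hp h]; ring
  · rw [wind_orbitLoop_vertex_of_not_mem hp h]; ring

/-- Each step of the turning rule moves each coordinate of the vertex by at most one. [folklore] -/
theorem abs_iterate_fst_sub_le (β : BondConfig (Site 2)) (p : Site 2 × Fin 4) (i : Fin 2) (m : ℕ) :
    |((nextCorner β)^[m] p).1 i - p.1 i| ≤ m := by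
  classical
  induction m with
  | zero => simp
  | succ m ih =>
    rw [iterate_succ_apply']
    set c := (nextCorner β)^[m] p
    have hstep : |(nextCorner β c).1 i - c.1 i| ≤ 1 := by
      by_cases h : cTgt c ∈ β
      · rw [nextCorner_of_mem h]
        simp only [Pi.add_apply, add_sub_cancel_left]
        generalize c.2 + 1 = k
        fin_cases k <;> fin_cases i <;> simp [cornerUnit]
      · rw [nextCorner_of_not_mem h]; simp
    calc |(nextCorner β c).1 i - p.1 i| = |((nextCorner β c).1 i - c.1 i) + (c.1 i - p.1 i)| := by ring_nf
      _ ≤ |(nextCorner β c).1 i - c.1 i| + |c.1 i - p.1 i| := abs_add_le _ _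
      _ ≤ 1 + m := add_le_add hstep ih
      _ = (m + 1 : ℕ) := by push_cast; ring

/-- The medial points of the orbit loop stay within distance `2Q + 1` of the base vertex. [folklore] -/
theorem dist_medialPoint_orbitLoop_lt {e : MedialVertex} (he : e ∈ orbitLoop β p) :
    dist (medialPoint 1 e) (meshPoint 1 p.1) < 2 * minimalPeriod (nextCorner β) p + 1 := by
  rw [orbitLoop, List.mem_map] at he
  obtain ⟨m, hm, rfl⟩ := he
  rw [List.mem_range] at hm
  set c := (nextCorner β)^[m] p with hc
  have h1 : dist (medialPoint 1 (cSrc c)) (meshPoint 1 c.1) = 1 / 2 := by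
    rw [medialPoint_cSrc, dist_eq_norm, add_sub_cancel_left]
    simp [norm_pow]
  have h2 : dist (meshPoint 1 c.1) (meshPoint 1 p.1) ≤ 2 * m := by
    have h0 := abs_iterate_fst_sub_le β p 0 m
    have h1' := abs_iterate_fst_sub_le β p 1 m
    rw [← hc] at h0 h1'
    rw [dist_eq_norm]
    have hre : (meshPoint 1 c.1 - meshPoint 1 p.1).re = ((c.1 0 - p.1 0 : ℤ) : ℝ) := by
      simp [meshPoint, Site.toComplex]
    have him : (meshPoint 1 c.1 - meshPoint 1 p.1).im = ((c.1 1 - p.1 1 : ℤ) : ℝ) := by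
      simp [meshPoint, Site.toComplex]
    refine (Complex.norm_le_abs_re_add_abs_im _).trans ?_
    rw [hre, him]
    have e0 : |((c.1 0 - p.1 0 : ℤ) : ℝ)| ≤ m := by exact_mod_cast h0
    have e1 : |((c.1 1 - p.1 1 : ℤ) : ℝ)| ≤ m := by exact_mod_cast h1'
    linarith
  have hmQ : (m : ℝ) + 1 ≤ minimalPeriod (nextCorner β) p := by exact_mod_cast hm
  calc dist (medialPoint 1 (cSrc c)) (meshPoint 1 p.1)
      ≤ dist (medialPoint 1 (cSrc c)) (meshPoint 1 c.1) + dist (meshPoint 1 c.1) (meshPoint 1 p.1) :=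
        dist_triangle _ _ _
    _ ≤ 1 / 2 + 2 * m := add_le_add h1.le h2
    _ < 2 * minimalPeriod (nextCorner β) p + 1 := by linarith

/-- `(cposOff k).1 ≥ -1`. [folklore] -/
theorem neg_one_le_cposOff_fst (k : Fin 4) : -1 ≤ (cposOff k).1 := by
  fin_cases k <;> decide

/-- **A vertex far to the west** around whose cell neither winding number is non-zero: the
analytic one because the loop stays in a ball around the base vertex, the combinatorial one
because the trail stays to the east. [folklore] -/
theorem exists_far_vertex (hp : p ∈ periodicPts (nextCorner β)) :
    ∃ v : Site 2, (loopCurve 1 0 (orbitLoop β p)).wind (meshPoint 1 v) = 0 ∧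
      wnd (orbitTrail β p) (vcell v) = 0 := by
  set Q := minimalPeriod (nextCorner β) p with hQ
  set v : Site 2 := p.1 + (2 * (Q : ℤ) + 2) • cornerUnit 2 with hv
  have hv0 : v 0 = p.1 0 - (2 * Q + 2) := by
    simp [hv, cornerUnit]; ring
  have hv1 : v 1 = p.1 1 := by
    simp [hv, cornerUnit]
  refine ⟨v, ?_, ?_⟩
  · refine CurveClass.wind_eq_zero_of_subset_ball (w := meshPoint 1 p.1) (ρ := 2 * Q + 1) _ ?_ ?_
    · exact range_loopCurve_zero_subset_of_convex 1 (isInterfaceLoop_orbitLoop hp).ne_nil (convex_ball _ _)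
        fun e he ↦ Metric.mem_ball.2 (dist_medialPoint_orbitLoop_lt he)
    · rw [dist_eq_norm]
      have hdiff : meshPoint 1 v - meshPoint 1 p.1 = ((-(2 * (Q : ℝ) + 2) : ℝ) : ℂ) := by
        apply Complex.ext <;> simp [meshPoint, Site.toComplex, hv0, hv1]
      rw [hdiff, Complex.norm_real, Real.norm_eq_abs, abs_of_nonpos (neg_nonpos.2 (by positivity))]
      linarith
  · apply wnd_eq_zero_of_lt
    intro P hP
    rw [orbitTrail, List.mem_map] at hP
    obtain ⟨m, hm, rfl⟩ := hP
    rw [List.mem_range] at hm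
    have h0 := abs_iterate_fst_sub_le β p 0 m
    have h1 := abs_iterate_fst_sub_le β p 1 m
    have hoff := neg_one_le_cposOff_fst ((nextCorner β)^[m] p).2
    rw [abs_le] at h0 h1
    simp only [hv0, hv1, cpos]
    omega

/-- **The bridge: analytic = combinatorial winding numbers on the cells.** For a periodic corner
`p` (any configuration), the winding number of the orbit loop around every vertex `v` of `ℤ²`
equals the combinatorial winding number of the orbit trail around the cell of `v`, and likewise
for face centres. Both differences `D` jump by the same amount across every corner (Step A), so
`D` is constant along lattice edges (the two endpoints are corners of a common face, Step B),
hence constant on `ℤ²` (Step C), and it vanishes at a far vertex (Step D). [folklore] -/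
theorem wind_orbitLoop_eq_wnd (hp : p ∈ periodicPts (nextCorner β)) :
    (∀ v : Site 2, (loopCurve 1 0 (orbitLoop β p)).wind (meshPoint 1 v) = wnd (orbitTrail β p) (vcell v)) ∧
      ∀ f : Site 2, (loopCurve 1 0 (orbitLoop β p)).wind (faceCenter f) = wnd (orbitTrail β p) (fcell f) := by
  -- Step A
  have hA : ∀ c : Site 2 × Fin 4,
      (loopCurve 1 0 (orbitLoop β p)).wind (meshPoint 1 c.1) - wnd (orbitTrail β p) (vcell c.1) =
        (loopCurve 1 0 (orbitLoop β p)).wind (faceCenter (cFace c)) - wnd (orbitTrail β p) (fcell (cFace c)) := by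
    intro c
    have h1 := wind_meshPoint_sub_wind_faceCenter_orbitLoop hp c
    have h2 := wnd_vcell_sub_wnd_fcell hp c
    have h := h1.trans h2.symm
    linarith
  -- Step B
  have hB : ∀ (v : Site 2) (k : Fin 4),
      (loopCurve 1 0 (orbitLoop β p)).wind (meshPoint 1 v) - wnd (orbitTrail β p) (vcell v) =
        (loopCurve 1 0 (orbitLoop β p)).wind (meshPoint 1 (v + cornerUnit k)) -
          wnd (orbitTrail β p) (vcell (v + cornerUnit k)) := by
    intro v k
    have h1 := hA (v, k)
    have h2 := hA (v + cornerUnit k, k + 1)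
    have hf : cFace (v + cornerUnit k, k + 1) = cFace (v, k) := faceAt_add_unit_succ v k
    rw [hf] at h2
    exact h1.trans h2.symm
  -- Step C
  have hC : ∀ v w : Site 2,
      (loopCurve 1 0 (orbitLoop β p)).wind (meshPoint 1 v) - wnd (orbitTrail β p) (vcell v) =
        (loopCurve 1 0 (orbitLoop β p)).wind (meshPoint 1 w) - wnd (orbitTrail β p) (vcell w) := by
    intro v w
    obtain ⟨walk⟩ := zdGraph_reachable v w
    induction walk with
    | nil => rfl
    | @cons a b _ hadj _ ih =>
      refine Eq.trans ?_ ih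
      obtain ⟨k, rfl⟩ : ∃ k : Fin 4, b = a + cornerUnit k := by
        rcases (zdGraph_two_adj_iff_add a b).1 hadj with h | h | h | h
        exacts [⟨0, h⟩, ⟨1, h⟩, ⟨2, h⟩, ⟨3, h⟩]
      exact hB a k
  -- Step D
  obtain ⟨v₀, hv₀, hv₀'⟩ := exists_far_vertex hp
  have hDv : ∀ v, (loopCurve 1 0 (orbitLoop β p)).wind (meshPoint 1 v) - wnd (orbitTrail β p) (vcell v) = 0 := by
    intro v; rw [hC v v₀, hv₀, hv₀']; simp
  refine ⟨fun v ↦ sub_eq_zero.1 (hDv v), fun f ↦ ?_⟩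
  have h := hA (f, 0)
  have hf : cFace (f, (0 : Fin 4)) = f := by
    show faceAt f 0 = f
    simp [faceAt, cornerOff]
  rw [hf] at h
  simp only at h
  rw [hDv f] at h
  exact sub_eq_zero.1 h.symm

/-- The bridge at vertices. [folklore] -/
theorem wind_orbitLoop_meshPoint_eq_wnd (hp : p ∈ periodicPts (nextCorner β)) (v : Site 2) :
    (loopCurve 1 0 (orbitLoop β p)).wind (meshPoint 1 v) = wnd (orbitTrail β p) (vcell v) :=
  (wind_orbitLoop_eq_wnd hp).1 v

/-- The bridge at face centres. [folklore] -/
theorem wind_orbitLoop_faceCenter_eq_wnd (hp : p ∈ periodicPts (nextCorner β)) (f : Site 2) :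
    (loopCurve 1 0 (orbitLoop β p)).wind (faceCenter f) = wnd (orbitTrail β p) (fcell f) :=
  (wind_orbitLoop_eq_wnd hp).2 f

end Orbit

/-! ### Cells of the plane and the medial lines -/

/-- The first medial coordinate `x + y - ½` of a point of the plane. [folklore] -/
def frameX (z : ℂ) : ℝ := z.re + z.im - 1 / 2

/-- The second medial coordinate `y - x + ½`. [folklore] -/
def frameY (z : ℂ) : ℝ := z.im - z.re + 1 / 2

/-- `frameX` is continuous. [folklore] -/
theorem continuous_frameX : Continuous frameX := by unfold frameX; fun_prop

/-- `frameY` is continuous. [folklore] -/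
theorem continuous_frameY : Continuous frameY := by unfold frameY; fun_prop

/-- **The open cell `F`** of the medial lattice of `ℤ²` (mesh `1`): the open diamond
`F.1 < x + y - ½ < F.1 + 1`, `F.2 < y - x + ½ < F.2 + 1`, around a vertex of `ℤ²` or a face
centre. [folklore] -/
def cellInterior (F : MedialTrail.Pt) : Set ℂ :=
  {z | (F.1 : ℝ) < frameX z ∧ frameX z < F.1 + 1 ∧ (F.2 : ℝ) < frameY z ∧ frameY z < F.2 + 1}

/-- The centre of the cell `F`, in the plane. [folklore] -/
def cellCenter (F : MedialTrail.Pt) : ℂ := ⟨((F.1 : ℝ) - F.2 + 1) / 2, ((F.1 : ℝ) + F.2 + 1) / 2⟩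

/-- **The medial lines**: the points with an integer medial coordinate (the union of all medial
edges of `ℤ²`, i.e. of the boundaries of the cells). [folklore] -/
def medialLines : Set ℂ := {z | (∃ n : ℤ, frameX z = n) ∨ ∃ n : ℤ, frameY z = n}

/-- Cells are open. [folklore] -/
theorem isOpen_cellInterior (F : MedialTrail.Pt) : IsOpen (cellInterior F) := by
  have h : cellInterior F = frameX ⁻¹' Set.Ioo (F.1 : ℝ) (F.1 + 1) ∩ frameY ⁻¹' Set.Ioo (F.2 : ℝ) (F.2 + 1) := by
    ext z; simp only [cellInterior, Set.mem_setOf_eq, Set.mem_inter_iff, Set.mem_preimage, Set.mem_Ioo]; tauto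
  rw [h]
  exact (isOpen_Ioo.preimage continuous_frameX).inter (isOpen_Ioo.preimage continuous_frameY)

/-- Cells are measurable. [folklore] -/
theorem measurableSet_cellInterior (F : MedialTrail.Pt) : MeasurableSet (cellInterior F) :=
  (isOpen_cellInterior F).measurableSet

/-- Cells are convex (intersections of four open half-planes). [folklore] -/
theorem convex_cellInterior (F : MedialTrail.Pt) : Convex ℝ (cellInterior F) := by
  have hl1 : IsLinearMap ℝ fun z : ℂ ↦ z.re + z.im :=
    { map_add := fun x y ↦ by simp; ring
      map_smul := fun c x ↦ by simp; ring }
  have hl2 : IsLinearMap ℝ fun z : ℂ ↦ z.im - z.re :=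
    { map_add := fun x y ↦ by simp; ring
      map_smul := fun c x ↦ by simp; ring }
  have h : cellInterior F = {z : ℂ | (F.1 : ℝ) + 1 / 2 < z.re + z.im} ∩ {z : ℂ | z.re + z.im < F.1 + 3 / 2} ∩
      {z : ℂ | (F.2 : ℝ) - 1 / 2 < z.im - z.re} ∩ {z : ℂ | z.im - z.re < F.2 + 1 / 2} := by
    ext z
    simp only [cellInterior, frameX, frameY, Set.mem_setOf_eq, Set.mem_inter_iff]
    constructor
    · rintro ⟨h1, h2, h3, h4⟩; exact ⟨⟨⟨by linarith, by linarith⟩, by linarith⟩, by linarith⟩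
    · rintro ⟨⟨⟨h1, h2⟩, h3⟩, h4⟩; exact ⟨by linarith, by linarith, by linarith, by linarith⟩
  rw [h]
  exact (((convex_halfSpace_gt hl1 _).inter (convex_halfSpace_lt hl1 _)).inter (convex_halfSpace_gt hl2 _)).inter
    (convex_halfSpace_lt hl2 _)

/-- The centre of a cell lies in it. [folklore] -/
theorem cellCenter_mem_cellInterior (F : MedialTrail.Pt) : cellCenter F ∈ cellInterior F := by
  simp only [cellInterior, cellCenter, frameX, frameY, Set.mem_setOf_eq]
  refine ⟨by linarith, by linarith, by linarith, by linarith⟩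

/-- The centre of the cell of a vertex is the vertex. [folklore] -/
theorem cellCenter_vcell (v : Site 2) : cellCenter (vcell v) = meshPoint 1 v := by
  apply Complex.ext <;> simp [cellCenter, vcell, meshPoint, Site.toComplex] <;> ring

/-- The centre of the cell of a face is the face centre. [folklore] -/
theorem cellCenter_fcell (f : Site 2) : cellCenter (fcell f) = faceCenter f := by
  apply Complex.ext <;> simp [cellCenter, fcell, faceCenter, Site.toComplex] <;> ring

/-- **Every cell is the cell of a vertex or of a face** (parity of `F.1 + F.2`). [folklore] -/
theorem exists_vcell_or_fcell (F : MedialTrail.Pt) : (∃ v : Site 2, F = vcell v) ∨ ∃ f : Site 2, F = fcell f := by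
  rcases Int.emod_two_eq_zero_or_one (F.1 + F.2) with h | h
  · right
    refine ⟨![(F.1 - F.2) / 2, (F.1 + F.2) / 2], Prod.ext ?_ ?_⟩ <;> simp [fcell] <;> omega
  · left
    refine ⟨![(F.1 - F.2 + 1) / 2, (F.1 + F.2 + 1) / 2], Prod.ext ?_ ?_⟩ <;> simp [vcell] <;> omega

/-- Cells are disjoint from the medial lines. [folklore] -/
theorem cellInterior_disjoint_medialLines (F : MedialTrail.Pt) : Disjoint (cellInterior F) medialLines := by
  rw [Set.disjoint_left]
  rintro z ⟨h1, h2, h3, h4⟩ (⟨n, hn⟩ | ⟨n, hn⟩)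
  · rw [hn] at h1 h2
    have e1 : F.1 < n := by exact_mod_cast h1
    have e2 : (n : ℝ) < F.1 + 1 := h2
    have e3 : n < F.1 + 1 := by exact_mod_cast e2
    omega
  · rw [hn] at h3 h4
    have e1 : F.2 < n := by exact_mod_cast h3
    have e3 : n < F.2 + 1 := by exact_mod_cast h4
    omega

/-- Distinct cells are disjoint. [folklore] -/
theorem cellInterior_disjoint {F F' : MedialTrail.Pt} (h : F ≠ F') : Disjoint (cellInterior F) (cellInterior F') := by
  rw [Set.disjoint_left]
  rintro z ⟨h1, h2, h3, h4⟩ ⟨h1', h2', h3', h4'⟩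
  apply h
  have a1 : (F.1 : ℝ) < F'.1 + 1 := by linarith
  have a2 : (F'.1 : ℝ) < F.1 + 1 := by linarith
  have b1 : (F.2 : ℝ) < F'.2 + 1 := by linarith
  have b2 : (F'.2 : ℝ) < F.2 + 1 := by linarith
  have a1' : F.1 < F'.1 + 1 := by exact_mod_cast a1
  have a2' : F'.1 < F.1 + 1 := by exact_mod_cast a2
  have b1' : F.2 < F'.2 + 1 := by exact_mod_cast b1
  have b2' : F'.2 < F.2 + 1 := by exact_mod_cast b2
  exact Prod.ext (by omega) (by omega)

/-- A point off the medial lines lies in the cell of the integer parts of its medial coordinates.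
[folklore] -/
theorem mem_cellInterior_floor {z : ℂ} (hz : z ∉ medialLines) :
    z ∈ cellInterior (⌊frameX z⌋, ⌊frameY z⌋) := by
  simp only [medialLines, Set.mem_setOf_eq, not_or, not_exists] at hz
  refine ⟨?_, Int.lt_floor_add_one _, ?_, Int.lt_floor_add_one _⟩
  · exact lt_of_le_of_ne (Int.floor_le _) (fun h ↦ hz.1 _ h.symm)
  · exact lt_of_le_of_ne (Int.floor_le _) (fun h ↦ hz.2 _ h.symm)

/-- The medial lines form a measurable set. [folklore] -/
theorem measurableSet_medialLines : MeasurableSet medialLines := by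
  have h : medialLines = ⋃ n : ℤ, (frameX ⁻¹' {(n : ℝ)} ∪ frameY ⁻¹' {(n : ℝ)}) := by
    ext z; simp [medialLines, ← exists_or]
  rw [h]
  exact MeasurableSet.iUnion fun n ↦
    ((isClosed_singleton.preimage continuous_frameX).measurableSet).union
      ((isClosed_singleton.preimage continuous_frameY).measurableSet)

/-- **The medial lines are Lebesgue-null** (a countable union of lines). [folklore] -/
theorem volume_medialLines : volume medialLines = 0 := by
  -- the two directions, as kernels of real-linear functionals
  let ℓ₁ : ℂ →ₗ[ℝ] ℝ := Complex.reLm + Complex.imLm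
  let ℓ₂ : ℂ →ₗ[ℝ] ℝ := Complex.imLm - Complex.reLm
  have hK1 : volume (LinearMap.ker ℓ₁ : Set ℂ) = 0 := by
    refine Measure.addHaar_submodule volume _ fun htop ↦ ?_
    have : (1 : ℂ) ∈ LinearMap.ker ℓ₁ := htop ▸ Submodule.mem_top
    simp [ℓ₁] at this
  have hK2 : volume (LinearMap.ker ℓ₂ : Set ℂ) = 0 := by
    refine Measure.addHaar_submodule volume _ fun htop ↦ ?_
    have : (Complex.I : ℂ) ∈ LinearMap.ker ℓ₂ := htop ▸ Submodule.mem_top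
    simp [ℓ₂] at this
  have hX : ∀ c : ℝ, volume {z : ℂ | frameX z = c} = 0 := by
    intro c
    have hset : {z : ℂ | frameX z = c} = (fun z : ℂ ↦ z + (-(c + 1 / 2 : ℝ) : ℂ)) ⁻¹' (LinearMap.ker ℓ₁ : Set ℂ) := by
      ext z
      simp only [frameX, Set.mem_setOf_eq, Set.mem_preimage, SetLike.mem_coe, LinearMap.mem_ker, ℓ₁]
      simp
      constructor <;> intro h <;> linarith
    rw [hset, measure_preimage_add_right]
    exact hK1
  have hY : ∀ c : ℝ, volume {z : ℂ | frameY z = c} = 0 := by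
    intro c
    have hset : {z : ℂ | frameY z = c} = (fun z : ℂ ↦ z + (-(c - 1 / 2 : ℝ) * Complex.I)) ⁻¹' (LinearMap.ker ℓ₂ : Set ℂ) := by
      ext z
      simp only [frameY, Set.mem_setOf_eq, Set.mem_preimage, SetLike.mem_coe, LinearMap.mem_ker, ℓ₂]
      simp
      constructor <;> intro h <;> linarith
    rw [hset, measure_preimage_add_right]
    exact hK2
  have h : medialLines = ⋃ n : ℤ, ({z : ℂ | frameX z = n} ∪ {z : ℂ | frameY z = n}) := by
    ext z; simp [medialLines, ← exists_or]
  rw [h]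
  exact measure_iUnion_null fun n ↦ measure_union_null (hX n) (hY n)

/-! ### The trace of an orbit loop lies on the medial lines; winding numbers on cells -/

section Cells

variable {β : BondConfig (Site 2)} {p : Site 2 × Fin 4}

/-- **The corner cut of a corner lies on a medial line**: the segment from the midpoint of the
source edge to the midpoint of the target edge of `(v, k)` has constant integer medial
coordinate (`x + y - ½ = v₀ + v₁` or `v₀ + v₁ - 1` for `k` even, `y - x + ½ = v₁ - v₀ + 1` or
`v₁ - v₀` for `k` odd). [folklore] -/
theorem segment_cSrc_cTgt_subset_medialLines (c : Site 2 × Fin 4) :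
    segment ℝ (medialPoint 1 (cSrc c)) (medialPoint 1 (cTgt c)) ⊆ medialLines := by
  obtain ⟨v, k⟩ := c
  rw [segment_subset_iff]
  intro a b _ _ hab
  obtain rfl : b = 1 - a := by linarith
  rw [medialPoint_cSrc, medialPoint_cTgt]
  simp only [medialLines, frameX, frameY, Set.mem_setOf_eq]
  fin_cases k
  · left; refine ⟨v 0 + v 1, ?_⟩
    simp [meshPoint, Site.toComplex]
    ring
  · right; refine ⟨v 1 - v 0 + 1, ?_⟩
    simp [meshPoint, Site.toComplex]
    ring
  · left; refine ⟨v 0 + v 1 - 1, ?_⟩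
    simp [meshPoint, Site.toComplex]
    ring
  · right; refine ⟨v 1 - v 0, ?_⟩
    simp [meshPoint, Site.toComplex]
    ring

/-- **The trace of the orbit loop lies on the medial lines.** [folklore] -/
theorem range_loopCurve_orbitLoop_subset_medialLines (hp : p ∈ periodicPts (nextCorner β)) :
    (loopCurve 1 0 (orbitLoop β p)).range ⊆ medialLines := by
  rw [range_loopCurve_zero 1 (isInterfaceLoop_orbitLoop hp).ne_nil, zip_rotate_orbitLoop]
  refine Set.iUnion₂_subset fun q hq ↦ ?_
  rw [List.mem_map] at hq
  obtain ⟨m, -, rfl⟩ := hq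
  exact segment_cSrc_cTgt_subset_medialLines _

/-- **The winding number of the orbit loop is constant on each open cell**, equal to its value at
the centre. [folklore] -/
theorem wind_orbitLoop_eq_of_mem_cellInterior (hp : p ∈ periodicPts (nextCorner β)) {F : MedialTrail.Pt}
    {z : ℂ} (hz : z ∈ cellInterior F) :
    (loopCurve 1 0 (orbitLoop β p)).wind z = (loopCurve 1 0 (orbitLoop β p)).wind (cellCenter F) := by
  refine CurveClass.wind_eq_of_segment_disjoint _ (isLoop_loopCurve 1 0 (isInterfaceLoop_orbitLoop hp).ne_nil) ?_
  refine Set.disjoint_of_subset ((convex_cellInterior F).segment_subset hz (cellCenter_mem_cellInterior F))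
    (range_loopCurve_orbitLoop_subset_medialLines hp) (cellInterior_disjoint_medialLines F)

/-- **On the cell `F` the winding number of the orbit loop is `wnd` of the orbit trail at `F`.**
[folklore] -/
theorem wind_orbitLoop_cellCenter_eq_wnd (hp : p ∈ periodicPts (nextCorner β)) (F : MedialTrail.Pt) :
    (loopCurve 1 0 (orbitLoop β p)).wind (cellCenter F) = wnd (orbitTrail β p) F := by
  rcases exists_vcell_or_fcell F with ⟨v, rfl⟩ | ⟨f, rfl⟩
  · rw [cellCenter_vcell]; exact wind_orbitLoop_meshPoint_eq_wnd hp v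
  · rw [cellCenter_fcell]; exact wind_orbitLoop_faceCenter_eq_wnd hp f

/-! ### The `φ`-mass of the interior of a loop as a corner functional -/

/-- The cell `F` drawn at mesh `δ`: the points `z` with `z/δ ∈ cellInterior F`. [folklore] -/
def scaledCell (δ : ℝ) (F : MedialTrail.Pt) : Set ℂ := (fun z : ℂ ↦ z / δ) ⁻¹' cellInterior F

/-- Scaled cells are measurable. [folklore] -/
theorem measurableSet_scaledCell (δ : ℝ) (F : MedialTrail.Pt) : MeasurableSet (scaledCell δ F) :=
  measurableSet_preimage (by fun_prop) (measurableSet_cellInterior F)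

/-- **The corner functional `κ_{φ,δ}`** of a signed measure `φ` at mesh `δ` (on the window `W` of
cells): `κ(c) = ∑_{F ∈ W} dartWnd(dart of c, F) · φ(δ·cell F)` — the contribution of the dart of
`c` to the pairing of `φ` with the winding number of any loop through `c`.
[cite: DuminilCopinKozlowskiLammersManolescu2026, §3.2 (3.2)] -/
def cornerKappa (φ : SignedMeasure ℂ) (δ : ℝ) (W : Finset MedialTrail.Pt) (c : Site 2 × Fin 4) : ℝ :=
  ∑ F ∈ W, (dartWnd (cornerDart c) F : ℝ) * φ (scaledCell δ F)

/-- The loop of the loop representation at mesh `δ` traced by the orbit of the periodic corner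
`p`: the unbased loop of `loopCurve δ 0 (orbitLoop β p)` (the element of `bondLoopConfig δ 0 β`
through `p`). [cite: arXiv201211672v2, §1.2] -/
def orbitUnbasedLoop (δ : ℝ) (β : BondConfig (Site 2)) (p : Site 2 × Fin 4)
    (hp : p ∈ periodicPts (nextCorner β)) : UnbasedLoop ℂ :=
  UnbasedLoop.mk (BasedLoop.mk (loopCurve δ 0 (orbitLoop β p))
    (isLoop_loopCurve δ 0 (isInterfaceLoop_orbitLoop hp).ne_nil))

/-- Winding numbers at mesh `δ` are winding numbers at mesh `1` of the rescaled point. [folklore] -/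
theorem wind_loopCurve_mesh {δ : ℝ} (hδ : δ ≠ 0) (γ : List MedialVertex) (z : ℂ) :
    (loopCurve δ 0 γ).wind z = (loopCurve 1 0 γ).wind (z / δ) := by
  have h := wind_loopCurve hδ 0 γ (z / δ)
  rw [Circle.exp_zero] at h
  simp only [rotation_apply, Circle.coe_one, one_mul] at h
  rwa [mul_div_cancel₀ _ (Complex.ofReal_ne_zero.2 hδ)] at h

/-- The interior of the orbit loop at mesh `δ` is the rescaled set of non-zero winding number at
mesh `1`. [cite: DuminilCopinKozlowskiLammersManolescu2026, §3.2 (int(ℓ))] -/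
theorem loopInterior_orbitUnbasedLoop {δ : ℝ} (hδ : δ ≠ 0) (hp : p ∈ periodicPts (nextCorner β)) :
    loopInterior (orbitUnbasedLoop δ β p hp) =
      (fun z : ℂ ↦ z / δ) ⁻¹' {w | (loopCurve 1 0 (orbitLoop β p)).wind w ≠ 0} := by
  ext z
  simp only [loopInterior, orbitUnbasedLoop, Set.mem_setOf_eq, Set.mem_preimage, UnbasedLoop.wind_mk,
    BasedLoop.toCurveClass_mk, wind_loopCurve_mesh hδ]

/-- `[wnd ≠ 0] · x = τ · wnd · x`. [folklore] -/
theorem ite_wnd_mul (hp : p ∈ periodicPts (nextCorner β)) (F : MedialTrail.Pt) (x : ℝ) :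
    (if wnd (orbitTrail β p) F ≠ 0 then x else 0) = orbitSign β p * wnd (orbitTrail β p) F * x := by
  rw [← indicator_wnd_orbitTrail hp F]
  split_ifs <;> simp

/-- The combinatorial winding number as the sum of the dart contributions along the orbit.
[folklore] -/
theorem wnd_orbitTrail_eq_sum (β : BondConfig (Site 2)) (p : Site 2 × Fin 4) (F : MedialTrail.Pt) :
    wnd (orbitTrail β p) F =
      ∑ m ∈ Finset.range (minimalPeriod (nextCorner β) p), dartWnd (cornerDart ((nextCorner β)^[m] p)) F := by
  rw [wnd, dwnd, cdarts_orbitTrail, List.map_map]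
  have key : ∀ (g : ℕ → ℤ) (n : ℕ), ((List.range n).map g).sum = ∑ m ∈ Finset.range n, g m := by
    intro g n
    induction n with
    | zero => simp
    | succ n ih => rw [List.range_succ, List.map_append, List.sum_append, ih, Finset.sum_range_succ]; simp
  exact key _ _

/-- **The `φ`-mass of the interior of a loop, cell by cell.** For a signed measure `φ` charging no
Lebesgue-null set, `δ > 0`, a periodic corner `p` and a finite window `W` of cells outside which
`φ` gives no mass to the scaled cells: `φ(int ℓ) = ∑_{F ∈ W, wnd F ≠ 0} φ(δ·cell F)` for the
loop `ℓ` of the loop representation at mesh `δ` through `p` (the interior is, up to the null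
medial lines, the disjoint union of the scaled cells of non-zero winding number).
[cite: DuminilCopinKozlowskiLammersManolescu2026, §3.2 (int(ℓ))] -/
theorem signedMeasure_loopInterior_eq_sum_cells {φ : SignedMeasure ℂ}
    (hφ : φ ≪ᵥ (volume : Measure ℂ).toENNRealVectorMeasure) {δ : ℝ} (hδ : 0 < δ)
    (hp : p ∈ periodicPts (nextCorner β)) (W : Finset MedialTrail.Pt)
    (hW : ∀ F ∉ W, φ (scaledCell δ F) = 0) :
    φ (loopInterior (orbitUnbasedLoop δ β p hp)) =
      ∑ F ∈ W, if wnd (orbitTrail β p) F ≠ 0 then φ (scaledCell δ F) else 0 := by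
  set A : Set ℂ := {w | (loopCurve 1 0 (orbitLoop β p)).wind w ≠ 0} with hA
  set sc : ℂ → ℂ := fun z ↦ z / δ with hsc
  have hscm : Measurable sc := by simp only [hsc]; fun_prop
  have hAo : IsOpen A := CurveClass.isOpen_setOf_wind_ne_zero _
  have hAm : MeasurableSet A := hAo.measurableSet
  rw [loopInterior_orbitUnbasedLoop hδ.ne' hp]
  change φ (sc ⁻¹' A) = _
  -- split off the medial lines
  have hsplit : sc ⁻¹' A = sc ⁻¹' (A ∩ medialLines) ∪ sc ⁻¹' (A \ medialLines) := by
    rw [← Set.preimage_union, Set.inter_union_sdiff]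
  have hnull : φ (sc ⁻¹' (A ∩ medialLines)) = 0 := by
    apply hφ
    rw [Measure.toENNRealVectorMeasure_apply_measurable (measurableSet_preimage hscm (hAm.inter measurableSet_medialLines))]
    refine measure_mono_null (Set.preimage_mono Set.inter_subset_right) ?_
    have : sc ⁻¹' medialLines = (fun z : ℂ ↦ (δ⁻¹ : ℝ) • z) ⁻¹' medialLines := by
      ext z; simp [hsc, div_eq_inv_mul, Complex.real_smul]
    rw [this, Measure.addHaar_preimage_smul _ (inv_ne_zero hδ.ne'), volume_medialLines, mul_zero]
  -- the rest is the disjoint union of the cells of non-zero winding number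
  have hcells : sc ⁻¹' (A \ medialLines) = ⋃ F : MedialTrail.Pt, sc ⁻¹' (A ∩ cellInterior F) := by
    ext z
    simp only [Set.mem_preimage, Set.mem_sdiff, Set.mem_iUnion, Set.mem_inter_iff]
    constructor
    · rintro ⟨hzA, hzL⟩
      exact ⟨_, hzA, mem_cellInterior_floor hzL⟩
    · rintro ⟨F, hzA, hzF⟩
      exact ⟨hzA, fun hL ↦ Set.disjoint_left.1 (cellInterior_disjoint_medialLines F) hzF hL⟩
  have hcellA : ∀ F : MedialTrail.Pt, sc ⁻¹' (A ∩ cellInterior F) =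
      if wnd (orbitTrail β p) F ≠ 0 then scaledCell δ F else ∅ := by
    intro F
    split_ifs with hF
    · ext z
      simp only [Set.mem_preimage, Set.mem_inter_iff, scaledCell]
      constructor
      · exact fun h ↦ h.2
      · intro hz
        refine ⟨?_, hz⟩
        show (loopCurve 1 0 (orbitLoop β p)).wind (z / δ) ≠ 0
        rw [wind_orbitLoop_eq_of_mem_cellInterior hp hz, wind_orbitLoop_cellCenter_eq_wnd hp]
        exact hF
    · ext z
      simp only [Set.mem_preimage, Set.mem_inter_iff, Set.mem_empty_iff_false, iff_false, not_and]
      intro hzA hz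
      apply hF
      rw [← wind_orbitLoop_cellCenter_eq_wnd hp, ← wind_orbitLoop_eq_of_mem_cellInterior hp hz]
      exact hzA
  have hdisj : Pairwise (Disjoint on fun F : MedialTrail.Pt ↦ sc ⁻¹' (A ∩ cellInterior F)) := by
    intro F F' hne
    refine Set.disjoint_of_subset (Set.preimage_mono Set.inter_subset_right)
      (Set.preimage_mono Set.inter_subset_right) ?_
    exact (cellInterior_disjoint hne).preimage sc
  have hmeas : ∀ F : MedialTrail.Pt, MeasurableSet (sc ⁻¹' (A ∩ cellInterior F)) := fun F ↦
    measurableSet_preimage hscm (hAm.inter (measurableSet_cellInterior F))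
  have hdisj0 : Disjoint (sc ⁻¹' (A ∩ medialLines)) (sc ⁻¹' (A \ medialLines)) :=
    (Set.disjoint_left.2 fun z hz1 hz2 ↦ hz2.2 hz1.2).preimage sc
  rw [hsplit, VectorMeasure.of_union hdisj0 (measurableSet_preimage hscm (hAm.inter measurableSet_medialLines))
    (by rw [hcells]; exact MeasurableSet.iUnion hmeas), hnull, zero_add, hcells,
    VectorMeasure.of_disjoint_iUnion hmeas hdisj]
  have hterm : ∀ F : MedialTrail.Pt, φ (sc ⁻¹' (A ∩ cellInterior F)) =
      if wnd (orbitTrail β p) F ≠ 0 then φ (scaledCell δ F) else 0 := by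
    intro F
    rw [hcellA F]
    split_ifs <;> simp
  simp_rw [hterm]
  exact tsum_eq_sum (s := W) (fun F hF ↦ by simp [hW F hF])

/-- **The `φ`-mass of the interior of a loop is a corner functional.** Let `φ` be a signed measure
on the plane charging no Lebesgue-null set (e.g. a density), `δ > 0`, `p` a periodic corner of a
configuration `β` and `W` a finite window of cells outside which `φ` gives no mass to the scaled
cells. Then for the loop `ℓ` of the loop representation at mesh `δ` through `p`,
`φ(int ℓ) = τ · ∑_{m < Q} κ_{φ,δ}(ρ^m p)`, `τ = ±1` its sense of rotation, `Q` its length,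
`κ` the corner functional `cornerKappa φ δ W`: by `signedMeasure_loopInterior_eq_sum_cells`,
the fact that the winding number is `τ` where non-zero (`inv_orbitTrail`), and
`wnd = ∑_darts dartWnd`. This is the form of DKLM's loop functional `cos_μ(φ(int ℓ))` consumed
by the Baxter–Kelland–Wu identity `bkw_free_piece`.
[cite: DuminilCopinKozlowskiLammersManolescu2026, §3.2 (3.2)] -/
theorem signedMeasure_loopInterior_orbitLoop {φ : SignedMeasure ℂ}
    (hφ : φ ≪ᵥ (volume : Measure ℂ).toENNRealVectorMeasure) {δ : ℝ} (hδ : 0 < δ)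
    (hp : p ∈ periodicPts (nextCorner β)) (W : Finset MedialTrail.Pt)
    (hW : ∀ F ∉ W, φ (scaledCell δ F) = 0) :
    φ (loopInterior (orbitUnbasedLoop δ β p hp)) =
      orbitSign β p * ∑ m ∈ Finset.range (minimalPeriod (nextCorner β) p),
        cornerKappa φ δ W ((nextCorner β)^[m] p) := by
  rw [signedMeasure_loopInterior_eq_sum_cells hφ hδ hp W hW]
  simp_rw [ite_wnd_mul hp, wnd_orbitTrail_eq_sum β p]
  push_cast
  simp_rw [Finset.mul_sum, Finset.sum_mul]
  rw [Finset.sum_comm]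
  refine Finset.sum_congr rfl fun m _ ↦ ?_
  rw [cornerKappa, Finset.mul_sum]
  exact Finset.sum_congr rfl fun F _ ↦ by ring

end Cells

end Literature.Probability.Percolation

end
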